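import Mathlib.Geometry.Manifold.LocalDiffeomorph
import Mathlib.Analysis.Convex.Contractible
import Literature.Geometry.Symplectic.GromovR4RelEndProofs
import Literature.Geometry.Symplectic.GromovMcDuffChartFormProofs
import Literature.Geometry.Kaehler.ManifoldFormsPullback
import HarnessLib

/-!
# The standard models of `gromov_puncturedStandard_diffeomorphic_R4` (non-vacuity, consistency)

Companion file of the cluster `GromovR4.lean` (the named fact
`Literature.Geometry.Symplectic.gromov_puncturedStandard_diffeomorphic_R4`: a contractible
punctured smooth 4-manifold `M ∖ {p}` carrying a symplectic form standard near `p` is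
diffeomorphic to `ℝ⁴` — Gromov 1985, §0.3.C, diffeomorphism conclusion),
`GromovR4RelEnd.lean`, `GromovR4Proofs.lean` (the fact is PROVED there from the single named
fact `gromov_recognitionR4_relEnd`, McDuff–Salamon 2017, Rem. 4.5.2 (viii)) and
`GromovR4RelEndProofs.lean` (`ω₀` as a form on the manifold `ℝ⁴`; the standard model of the
relative fact). provefact seat of `gromov_puncturedStandard_diffeomorphic_R4`.

**No discharge is claimed**: `gromov_puncturedStandard_diffeomorphic_R4_holds` is, through the
proved reduction `gromov_puncturedStandard_diffeomorphic_R4_of_relEnd`, exactly Gromov's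
recognition theorem for `(ℝ⁴, ω₀)` (pseudo-holomorphic spheres: tame almost complex
structures, Fredholm theory and automatic transversality in dimension four, Gromov
compactness, positivity of intersections and the adjunction formula, the two transverse
foliations by holomorphic planes; Gromov 1985, 2.4.A₁′–A₁″; McDuff–Salamon 2012, §9.4;
Wendl 2020, Thms. 1–2), none of whose ingredients has vocabulary in Mathlib or the tree
(census in the seat notes). Everything in this file is PROVED; no named fact is introduced.

## What is proved

The hypothesis list of the fact quantifies over an arbitrary smooth 4-manifold `M`, a point
`p` and a `2`-form `sf` on `M ∖ {p}` subject to five tree-specific predicates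
(`IsSymplecticStandardNearPoint p ε sf`: `IsSmoothForm`, `IsClosedForm`, pointwise
nondegeneracy, and the chart-level "standard at infinity" clause `sf = (ι ∘ (e − e p))*ω₀` on
a punctured chart-ball; plus `ContractibleSpace (M ∖ {p})`). This file shows that the list is
**jointly satisfiable, in every intended model, with the conclusion holding there** — so the
fact is neither vacuously true nor refuted by its models:

* §1 `f*ω₀` for a `C^∞` map `f : N → ℝ⁴` of a `C^∞` manifold (`stdSymplecticMForm.pullback`,
  the tree's pull-back of `ManifoldFormsPullback.lean`): it is smooth and closed
  (`isSmoothForm_stdSymplecticMForm_pullback`, `isClosedForm_stdSymplecticMForm_pullback`: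
  Warner 2.22–2.23 and `dω₀ = 0`), evaluates as `ω₀(df v, df w)`
  (`stdSymplecticMForm_pullback_apply`), and is pointwise nondegenerate when `f` is a
  diffeomorphism (`stdSymplecticMForm_pullback_nondegenerate`: `df_x` is an isomorphism).
* §2 **The standard end.** If `Φ : M ∖ {p} ≃ₘ ℝ⁴` agrees with the inverted recentred chart
  `ι ∘ (e − e p)` on the punctured chart-ball of radius `ε` at `p` (the predicate
  `AgreesWithInvertedChartNear` of `StandardEnd.lean`), then `Φ*ω₀` is symplectic and
  standard near `p` with the same radius: `isSymplecticStandardNearPoint_pullback` (on the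
  punctured ball `dΦ = Dι ∘ De` by the chain rule, so `Φ*ω₀ = (ι*ω₀)_{e x − e p}(De ·, De ·)`
  verbatim), and `M ∖ {p}` is contractible (`contractibleSpace_punctured_of_diffeomorph`).
  This is the sentence "`(ℝ⁴, ω₀)` is symplectically standard at infinity" of Gromov 1985,
  §0.3.C, read in the chart packaging of the fact.
* §3 **Every smooth 4-manifold diffeomorphic to `S⁴` is a model**, at every point: by the
  tree's PROVED chart form of Palais' disc theorem (`palais_puncturedSphere_chartForm_holds`,
  `GromovMcDuffChartFormProofs.lean`) such a `Φ` exists, whence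
  `exists_isSymplecticStandardNearPoint_of_nonempty_diffeomorph_sphere`,
  `gromov_puncturedStandard_diffeomorphic_R4.hypotheses_of_nonempty_diffeomorph_sphere` (all
  hypotheses of the fact hold for some `ε, sf`) and
  `gromov_puncturedStandard_diffeomorphic_R4.conclusion_of_nonempty_diffeomorph_sphere` (its
  conclusion holds); in particular for the round sphere `S⁴ ⊆ ℝ⁵` itself
  (`….sphere_hypotheses`, `….sphere_conclusion`, `….apply_sphere`). By Gromov's theorem
  and Cerf's `Γ₄ = 0` these are in fact ALL the models (that is the content of the fact
  together with route SymplecticCap's assembly), which is of course not proved here.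
* §3 also records the direction "SPC4 ⇒ thesis" noted in the docstring of the route item
  `stmt-SmoothPoincare4-0427` (`S⁴ ∖ p = ℂ²` with the stereographic chart): a homotopy
  4-sphere diffeomorphic to `S⁴` carries, on the complement of each of its points, a
  symplectic form standard near the puncture
  (`HomotopySphere.exists_isSymplecticStandardNearPoint_of_diffeomorph_sphere`).

## References

* M. Gromov, *Pseudo holomorphic curves in symplectic manifolds*, Invent. Math. 82 (1985)
  307–347, §0.3.C (manifolds symplectically diffeomorphic to `(ℝ⁴, ω₀)` at infinity; the
  model `(ℝ⁴, ω₀)` itself) [Gromov1985].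
* D. McDuff, D. Salamon, *Introduction to Symplectic Topology*, 3rd ed., OUP 2017, §1.1
  (1.1.20)–(1.1.21) (`ω₀`), Remark 4.5.2 (viii) [McDuffSalamon2017].
* F. W. Warner, *Foundations of Differentiable Manifolds and Lie Groups*, GTM 94 (1983),
  2.22–2.23 (pull-back of forms, naturality of `d`) [WarnerGTM94].
* R. S. Palais, *Extending diffeomorphisms*, Proc. AMS 11 (1960) 274–277, Thm. B
  [Palais1960].

The model space `EuclideanSpace ℝ (Fin 4)` and the sphere
`Metric.sphere (0 : EuclideanSpace ℝ (Fin 5)) 1` are spelled out in full (no local notation).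
-/

noncomputable section

open scoped Manifold ContDiff Topology
open TopologicalSpace Set Literature.Geometry.Kaehler

namespace Literature.Geometry.Symplectic

/-! ### §1 `f*ω₀` for a smooth map into `ℝ⁴` -/

section Pullback

variable {EM : Type*} [NormedAddCommGroup EM] [NormedSpace ℝ EM] {HM : Type*}
  [TopologicalSpace HM] {I : ModelWithCorners ℝ EM HM}
  {N : Type*} [TopologicalSpace N] [ChartedSpace HM N]

/-- `(f*ω₀)_x(v, w) = ω₀(df_x v, df_x w)` (Warner (1983), 2.22, for the constant form `ω₀`
of `GromovR4RelEndProofs.lean`). [cite: WarnerGTM94, 2.22] -/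
theorem stdSymplecticMForm_pullback_apply (f : N → EuclideanSpace ℝ (Fin 4)) (x : N)
    (v w : TangentSpace I x) :
    stdSymplecticMForm.pullback I f x ![v, w] =
      stdSymplecticForm (mfderiv I (𝓡 4) f x v) (mfderiv I (𝓡 4) f x w) := by
  rw [MForm.pullback_apply]
  have h : (fun i => mfderiv I (𝓡 4) f x (![v, w] i)) =
      ![mfderiv I (𝓡 4) f x v, mfderiv I (𝓡 4) f x w] := by
    funext i
    fin_cases i <;> rfl
  rw [h]
  exact stdSymplecticMForm_apply (f x) _ _

/-- **`Φ*ω₀` is pointwise nondegenerate for a diffeomorphism `Φ : N ≃ₘ ℝ⁴`**: `dΦ_x` is a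
linear isomorphism (`Diffeomorph.mfderivToContinuousLinearEquiv`), so for `v ≠ 0` the vector
`dΦ_x v` is nonzero, pairs non-trivially with some `w'` under `ω₀`
(`stdSymplecticMForm_nondegenerate`: `ω₀(u, J₀u) = ‖u‖²`), and `w' = dΦ_x w` for
`w = (dΦ_x)⁻¹ w'`. [cite: McDuffSalamon2017, §1.1 (1.1.21)] -/
theorem stdSymplecticMForm_pullback_nondegenerate
    (Φ : N ≃ₘ⟮I, 𝓡 4⟯ EuclideanSpace ℝ (Fin 4)) (x : N) (v : TangentSpace I x) (hv : v ≠ 0) :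
    ∃ w : TangentSpace I x, stdSymplecticMForm.pullback I Φ x ![v, w] ≠ 0 := by
  have hn : (∞ : WithTop ℕ∞) ≠ 0 := by simp
  set L := Φ.mfderivToContinuousLinearEquiv hn x with hL_def
  have hL : ∀ u, L u = mfderiv I (𝓡 4) Φ x u := fun u => rfl
  have hLv : L v ≠ 0 := fun h0 => hv (L.injective (h0.trans (map_zero L).symm))
  obtain ⟨w', hw'⟩ := stdSymplecticMForm_nondegenerate (Φ x) (L v) hLv
  refine ⟨L.symm w', ?_⟩
  rw [stdSymplecticMForm_pullback_apply, ← hL, ← hL, L.apply_symm_apply]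
  rwa [stdSymplecticMForm_apply] at hw'

variable [IsManifold I ∞ N]

/-- **`f*ω₀` is a smooth form** for `f : N → ℝ⁴` of class `C^∞` (Warner (1983), 2.22, via the
tree's proved pull-back calculus `isSmoothForm_pullback` and `isSmoothForm_stdSymplecticMForm`).
[cite: WarnerGTM94, 2.22] -/
theorem isSmoothForm_stdSymplecticMForm_pullback {f : N → EuclideanSpace ℝ (Fin 4)}
    (hf : ContMDiff I (𝓡 4) ∞ f) : IsSmoothForm (stdSymplecticMForm.pullback I f) :=
  Literature.NumberTheory.Transcendental.isSmoothForm_pullback hf isSmoothForm_stdSymplecticMForm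

/-- **`f*ω₀` is closed** for `f` of class `C^∞`: `d(f*ω₀) = f*(dω₀) = f*0 = 0` (naturality
of `d`, Warner (1983), Prop. 2.23, `mextDeriv_pullback`; `dω₀ = 0`,
`isClosedForm_stdSymplecticMForm`). [cite: WarnerGTM94, Prop. 2.23] -/
theorem isClosedForm_stdSymplecticMForm_pullback {f : N → EuclideanSpace ℝ (Fin 4)}
    (hf : ContMDiff I (𝓡 4) ∞ f) : IsClosedForm (stdSymplecticMForm.pullback I f) := by
  show mextDeriv (stdSymplecticMForm.pullback I f) = 0
  rw [Literature.NumberTheory.Transcendental.mextDeriv_pullback hf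
    isSmoothForm_stdSymplecticMForm]
  have h0 : mextDeriv stdSymplecticMForm = 0 := isClosedForm_stdSymplecticMForm
  rw [h0, MForm.pullback_zero]

end Pullback

/-! ### §2 A diffeomorphism in chart form at the puncture pulls `ω₀` back to a standard end -/

section ChartForm

variable {M : Type*} [TopologicalSpace M] [T2Space M] [ChartedSpace (EuclideanSpace ℝ (Fin 4)) M]

/-- The punctured chart-ball `{x ≠ p | x ∈ (chartAt p).source, e x ∈ ball (e p) ε}` is open
in `M ∖ {p}`. [folklore] -/
theorem isOpen_setOf_inPuncturedChartBall (p : M) (ε : ℝ) :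
    IsOpen {x : punctured p | InPuncturedChartBall p ε x} := by
  have h : IsOpen ((extChartAt (𝓡 4) p).source ∩
      extChartAt (𝓡 4) p ⁻¹' Metric.ball (extChartAt (𝓡 4) p p) ε) :=
    (continuousOn_extChartAt (I := 𝓡 4) p).isOpen_inter_preimage
      (isOpen_extChartAt_source (I := 𝓡 4) p) Metric.isOpen_ball
  rw [extChartAt_source] at h
  exact h.preimage continuous_subtype_val

/-- A punctured manifold diffeomorphic to `ℝ⁴` is contractible (`ℝ⁴` is:
`RealTopologicalVectorSpace.contractibleSpace`; contractibility is a homeomorphism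
invariant). [folklore] -/
theorem contractibleSpace_punctured_of_diffeomorph (p : M)
    (Φ : (punctured p) ≃ₘ⟮𝓡 4, 𝓡 4⟯ EuclideanSpace ℝ (Fin 4)) :
    ContractibleSpace (punctured p) :=
  Φ.toHomeomorph.contractibleSpace

variable [IsManifold (𝓡 4) ∞ M]

/-- **Chain rule for the inverted recentred chart** `ψ = ι ∘ (e − e p)` on `M ∖ {p}`,
`e = extChartAt (𝓡 4) p`: at a point `x ≠ p` of the chart source, `ψ` has derivative
`dψ_x = Dι(e x − e p) ∘ De_x` (there `e x − e p ≠ 0` by injectivity of the chart, so `ι` is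
differentiable; `e ∘ Subtype.val` is `C^∞` on the chart source). [folklore] -/
theorem hasMFDerivAt_inversion_extChartAt_sub (p : M) (x : punctured p)
    (hx : x.1 ∈ (chartAt (EuclideanSpace ℝ (Fin 4)) p).source) :
    HasMFDerivAt (𝓡 4) 𝓘(ℝ, EuclideanSpace ℝ (Fin 4))
      (fun z : punctured p => inversion (extChartAt (𝓡 4) p z.1 - extChartAt (𝓡 4) p p)) x
      ((fderiv ℝ inversion (extChartAt (𝓡 4) p x.1 - extChartAt (𝓡 4) p p)).comp
        (mfderiv (𝓡 4) 𝓘(ℝ, EuclideanSpace ℝ (Fin 4))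
          (fun z : punctured p => extChartAt (𝓡 4) p z.1) x)) := by
  set e := extChartAt (𝓡 4) p with he_def
  have hsrc_eq : (chartAt (EuclideanSpace ℝ (Fin 4)) p).source = e.source :=
    (extChartAt_source (I := 𝓡 4) p).symm
  have hne : e x.1 - e p ≠ 0 := by
    intro h0
    have h1 : e x.1 = e p := sub_eq_zero.1 h0
    have h2 : x.1 = p :=
      e.injOn (show x.1 ∈ e.source from hsrc_eq ▸ hx)
        (show p ∈ e.source from mem_extChartAt_source (I := 𝓡 4) p) h1
    exact (mem_punctured.1 x.2) h2
  have hE : ContMDiffOn (𝓡 4) 𝓘(ℝ, EuclideanSpace ℝ (Fin 4)) ∞ (fun z : punctured p => e z.1)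
      {z : punctured p | z.1 ∈ (chartAt (EuclideanSpace ℝ (Fin 4)) p).source} :=
    (contMDiffOn_extChartAt (I := 𝓡 4) (x := p) (n := ∞)).comp
      (contMDiff_subtype_val (I := 𝓡 4) (n := ∞) (U := punctured p)).contMDiffOn
      (fun z hz => hz)
  have hEx : MDifferentiableAt (𝓡 4) 𝓘(ℝ, EuclideanSpace ℝ (Fin 4))
      (fun z : punctured p => e z.1) x :=
    (hE x hx).mdifferentiableWithinAt (by simp) |>.mdifferentiableAt
      ((continuous_subtype_val.isOpen_preimage _
        (chartAt (EuclideanSpace ℝ (Fin 4)) p).open_source).mem_nhds hx)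
  have hg : HasFDerivAt (fun y : EuclideanSpace ℝ (Fin 4) => inversion (y - e p))
      (fderiv ℝ inversion (e x.1 - e p)) (e x.1) := by
    have h1 : HasFDerivAt inversion (fderiv ℝ inversion (e x.1 - e p)) (e x.1 - e p) :=
      (differentiableAt_inversion hne).hasFDerivAt
    have h2 := h1.comp (e x.1) (hasFDerivAt_sub_const (e p))
    rw [ContinuousLinearMap.comp_id] at h2
    exact h2
  have hcomp := hg.hasMFDerivAt.comp x hEx.hasMFDerivAt
  exact hcomp

/-- Pointwise form of the chain rule: `dψ_x v = Dι(e x − e p) (De_x v)`. [folklore] -/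
theorem mfderiv_inversion_extChartAt_sub (p : M) (x : punctured p)
    (hx : x.1 ∈ (chartAt (EuclideanSpace ℝ (Fin 4)) p).source) (v : TangentSpace (𝓡 4) x) :
    mfderiv (𝓡 4) 𝓘(ℝ, EuclideanSpace ℝ (Fin 4))
        (fun z : punctured p => inversion (extChartAt (𝓡 4) p z.1 - extChartAt (𝓡 4) p p)) x v =
      fderiv ℝ inversion (extChartAt (𝓡 4) p x.1 - extChartAt (𝓡 4) p p)
        (mfderiv (𝓡 4) 𝓘(ℝ, EuclideanSpace ℝ (Fin 4))
          (fun z : punctured p => extChartAt (𝓡 4) p z.1) x v) := by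
  rw [(hasMFDerivAt_inversion_extChartAt_sub p x hx).mfderiv]
  rfl

/-- **The standard end, pulled back** (Gromov 1985, §0.3.C: `(ℝ⁴, ω₀)` is symplectically
standard at infinity — here in the chart packaging of `IsSymplecticStandardNearPoint`). Let
`Φ : M ∖ {p} ≃ₘ ℝ⁴` be a diffeomorphism which on the punctured chart-ball of radius `ε > 0`
at `p` equals the inverted recentred chart `ι ∘ (e − e p)`. Then `sf = Φ*ω₀` is a smooth,
closed, pointwise nondegenerate `2`-form on `M ∖ {p}` which on that punctured chart-ball
equals `(ι*ω₀)_{e x − e p}(De_x ·, De_x ·)`, i.e. `IsSymplecticStandardNearPoint p ε (Φ*ω₀)`: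
the punctured ball is open, so `dΦ_x = dψ_x = Dι(e x − e p) ∘ De_x` there
(`hasMFDerivAt_inversion_extChartAt_sub`). [cite: Gromov1985, §0.3.C] -/
theorem isSymplecticStandardNearPoint_pullback (p : M)
    (Φ : (punctured p) ≃ₘ⟮𝓡 4, 𝓡 4⟯ EuclideanSpace ℝ (Fin 4)) {ε : ℝ} (hε : 0 < ε)
    (hΦ : ∀ x : punctured p, InPuncturedChartBall p ε x →
      Φ x = inversion (extChartAt (𝓡 4) p x.1 - extChartAt (𝓡 4) p p)) :
    IsSymplecticStandardNearPoint p ε (stdSymplecticMForm.pullback (𝓡 4) Φ) := by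
  refine ⟨hε, isSmoothForm_stdSymplecticMForm_pullback Φ.contMDiff,
    isClosedForm_stdSymplecticMForm_pullback Φ.contMDiff,
    fun x v hv => stdSymplecticMForm_pullback_nondegenerate Φ x v hv, ?_⟩
  intro x hxs hxb v w
  have hx : InPuncturedChartBall p ε x := ⟨hxs, hxb⟩
  have hev : (⇑Φ : punctured p → EuclideanSpace ℝ (Fin 4)) =ᶠ[𝓝 x]
      fun z : punctured p => inversion (extChartAt (𝓡 4) p z.1 - extChartAt (𝓡 4) p p) :=
    Filter.eventuallyEq_of_mem ((isOpen_setOf_inPuncturedChartBall p ε).mem_nhds hx)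
      fun z hz => hΦ z hz
  have hΦ' := (hasMFDerivAt_inversion_extChartAt_sub p x hxs).congr_of_eventuallyEq hev
  rw [stdSymplecticMForm_pullback_apply, hΦ'.mfderiv]
  rfl

/-- The same from the packaged predicate `AgreesWithInvertedChartNear p Φ` (some radius).
[cite: Gromov1985, §0.3.C] -/
theorem exists_isSymplecticStandardNearPoint_pullback (p : M)
    (Φ : (punctured p) ≃ₘ⟮𝓡 4, 𝓡 4⟯ EuclideanSpace ℝ (Fin 4))
    (hΦ : AgreesWithInvertedChartNear p Φ) :
    ∃ ε : ℝ, IsSymplecticStandardNearPoint p ε (stdSymplecticMForm.pullback (𝓡 4) Φ) := by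
  obtain ⟨ε, hε, h⟩ := hΦ
  exact ⟨ε, isSymplecticStandardNearPoint_pullback p Φ hε fun x hx => h x hx.1 hx.2⟩

end ChartForm

/-! ### §3 The models: smooth 4-manifolds diffeomorphic to `S⁴`, punctured anywhere -/

section SphereModels

variable {M : Type} [TopologicalSpace M] [T2Space M] [SecondCountableTopology M]
  [ChartedSpace (EuclideanSpace ℝ (Fin 4)) M] [IsManifold (𝓡 4) ∞ M]

/-- **A smooth 4-manifold diffeomorphic to `S⁴` carries, on the complement of each point, a
symplectic form standard near the puncture**: `Φ*ω₀` for the chart-form diffeomorphism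
`Φ : M ∖ {p} ≃ₘ ℝ⁴` of Palais' theorem (`palais_puncturedSphere_chartForm_holds`). This is
`(S⁴ ∖ pt, ω₀) = (ℝ⁴, ω₀)` read through the atlas of `M` — the model of Gromov 1985,
§0.3.C. [cite: Gromov1985, §0.3.C] -/
theorem exists_isSymplecticStandardNearPoint_of_nonempty_diffeomorph_sphere
    (hM : Nonempty (M ≃ₘ⟮𝓡 4, 𝓡 4⟯ Metric.sphere (0 : EuclideanSpace ℝ (Fin 5)) 1)) (p : M) :
    ∃ (ε : ℝ) (sf : MForm (𝓡 4) (punctured p) ℝ 2),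
      IsSymplecticStandardNearPoint p ε sf := by
  obtain ⟨Φ, hΦ⟩ := palais_puncturedSphere_chartForm_holds M p hM
  obtain ⟨ε, hε⟩ := exists_isSymplecticStandardNearPoint_pullback p Φ hΦ
  exact ⟨ε, _, hε⟩

/-- The punctures of a smooth 4-manifold diffeomorphic to `S⁴` are contractible (they are
diffeomorphic to `ℝ⁴`). [folklore] -/
theorem contractibleSpace_punctured_of_nonempty_diffeomorph_sphere
    (hM : Nonempty (M ≃ₘ⟮𝓡 4, 𝓡 4⟯ Metric.sphere (0 : EuclideanSpace ℝ (Fin 5)) 1)) (p : M) :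
    ContractibleSpace (punctured p) := by
  obtain ⟨Φ, -⟩ := palais_puncturedSphere_chartForm_holds M p hM
  exact contractibleSpace_punctured_of_diffeomorph p Φ

/-- **Non-vacuity of `gromov_puncturedStandard_diffeomorphic_R4` in every intended model**:
for a smooth 4-manifold `M` diffeomorphic to `S⁴` and any `p ∈ M`, ALL hypotheses of the
named fact hold for some radius `ε` and some `2`-form `sf` on `M ∖ {p}` (`sf` symplectic and
standard near `p`, `M ∖ {p}` contractible). Hence the hypothesis list of the fact is jointly
satisfiable and the fact is not vacuously true. [cite: Gromov1985, §0.3.C] -/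
theorem gromov_puncturedStandard_diffeomorphic_R4.hypotheses_of_nonempty_diffeomorph_sphere
    (hM : Nonempty (M ≃ₘ⟮𝓡 4, 𝓡 4⟯ Metric.sphere (0 : EuclideanSpace ℝ (Fin 5)) 1)) (p : M) :
    ∃ (ε : ℝ) (sf : MForm (𝓡 4) (punctured p) ℝ 2),
      IsSymplecticStandardNearPoint p ε sf ∧ ContractibleSpace (punctured p) := by
  obtain ⟨ε, sf, hs⟩ :=
    exists_isSymplecticStandardNearPoint_of_nonempty_diffeomorph_sphere hM p
  exact ⟨ε, sf, hs, contractibleSpace_punctured_of_nonempty_diffeomorph_sphere hM p⟩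

/-- **Consistency: the conclusion of the fact holds in these models** — `M ∖ {p}` is
diffeomorphic to `ℝ⁴` whenever `M ≅ S⁴` (outright, by Palais' chart form; by Gromov's
theorem and Cerf's `Γ₄ = 0` these are all the models, which is not proved here).
[folklore] -/
theorem gromov_puncturedStandard_diffeomorphic_R4.conclusion_of_nonempty_diffeomorph_sphere
    (hM : Nonempty (M ≃ₘ⟮𝓡 4, 𝓡 4⟯ Metric.sphere (0 : EuclideanSpace ℝ (Fin 5)) 1)) (p : M) :
    Nonempty ((punctured p) ≃ₘ⟮𝓡 4, 𝓡 4⟯ EuclideanSpace ℝ (Fin 4)) := by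
  obtain ⟨Φ, -⟩ := palais_puncturedSphere_chartForm_holds M p hM
  exact ⟨Φ⟩

/-- **The round sphere is a model**: for every `p ∈ S⁴` the hypotheses of the fact hold on
`S⁴ ∖ {p}` for some `ε, sf`. [cite: Gromov1985, §0.3.C] -/
theorem gromov_puncturedStandard_diffeomorphic_R4.sphere_hypotheses
    (p : Metric.sphere (0 : EuclideanSpace ℝ (Fin 5)) 1) :
    ∃ (ε : ℝ) (sf : MForm (𝓡 4) (punctured p) ℝ 2),
      IsSymplecticStandardNearPoint p ε sf ∧ ContractibleSpace (punctured p) :=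
  gromov_puncturedStandard_diffeomorphic_R4.hypotheses_of_nonempty_diffeomorph_sphere
    ⟨Diffeomorph.refl (𝓡 4) (Metric.sphere (0 : EuclideanSpace ℝ (Fin 5)) 1) ∞⟩ p

/-- … and its conclusion holds there: `S⁴ ∖ {p} ≅ ℝ⁴`. [folklore] -/
theorem gromov_puncturedStandard_diffeomorphic_R4.sphere_conclusion
    (p : Metric.sphere (0 : EuclideanSpace ℝ (Fin 5)) 1) :
    Nonempty ((punctured p) ≃ₘ⟮𝓡 4, 𝓡 4⟯ EuclideanSpace ℝ (Fin 4)) :=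
  gromov_puncturedStandard_diffeomorphic_R4.conclusion_of_nonempty_diffeomorph_sphere
    ⟨Diffeomorph.refl (𝓡 4) (Metric.sphere (0 : EuclideanSpace ℝ (Fin 5)) 1) ∞⟩ p

/-- **The named fact instantiates at the round sphere** (its binders and hypothesis shapes
are met by `sphere_hypotheses`): under `gromov_puncturedStandard_diffeomorphic_R4`,
`S⁴ ∖ {p} ≅ ℝ⁴` — which `sphere_conclusion` also proves outright. [cite: Gromov1985, §0.3.C] -/
theorem gromov_puncturedStandard_diffeomorphic_R4.apply_sphere
    (h : gromov_puncturedStandard_diffeomorphic_R4)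
    (p : Metric.sphere (0 : EuclideanSpace ℝ (Fin 5)) 1) :
    Nonempty ((punctured p) ≃ₘ⟮𝓡 4, 𝓡 4⟯ EuclideanSpace ℝ (Fin 4)) := by
  obtain ⟨ε, sf, hs, hc⟩ := gromov_puncturedStandard_diffeomorphic_R4.sphere_hypotheses p
  exact h (Metric.sphere (0 : EuclideanSpace ℝ (Fin 5)) 1) p ε sf hs hc

/-- **"SPC4 ⇒ thesis" for route SymplecticCap's crux `stmt-SmoothPoincare4-0427`/`0518`**
(`∀ Σ p, ∃ ε sf, IsSymplecticStandardNearPoint p ε sf`), as noted in that item's docstring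
("`S⁴ ∖ p = ℂ²` with stereographic chart"): a homotopy 4-sphere which is diffeomorphic to
`S⁴` carries on the complement of each point a symplectic form standard near the puncture.
(The converse direction is the route's use of the Gromov–McDuff facts.)
[cite: Gromov1985, §0.3.C] -/
theorem _root_.Literature.Topology.FourManifolds.HomotopySphere.exists_isSymplecticStandardNearPoint_of_diffeomorph_sphere
    (S : Literature.Topology.FourManifolds.HomotopySphere 4)
    (hS : Nonempty (S.carrier ≃ₘ⟮𝓡 4, 𝓡 4⟯ Metric.sphere (0 : EuclideanSpace ℝ (Fin 5)) 1))
    (p : S.carrier) :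
    ∃ (ε : ℝ) (sf : MForm (𝓡 4) (punctured p) ℝ 2), IsSymplecticStandardNearPoint p ε sf :=
  Literature.Geometry.Symplectic.exists_isSymplecticStandardNearPoint_of_nonempty_diffeomorph_sphere
    hS p

end SphereModels

end Literature.Geometry.Symplectic

end
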